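import Literature.Analysis.FluidPDE.EnergySpaceTorus
import Literature.Analysis.FluidPDE.LerayProjectorTorusProofs
import Literature.Analysis.FluidPDE.StokesTorusSelfAdjointProofs
import HarnessLib

/-!
# The energy space on the torus: `H = {v ∈ L² | div v = 0 weakly, ∫ v = 0}` (proof)

`Literature.Analysis.FunctionSpaces.TorusSobolevSpace` defines the energy space
`H = Torus.energySpace d` of incompressible hydrodynamics on the flat torus `T^d` as the `L²`
closure of the span of the smooth divergence-free mean-zero fields `𝒱`
(Constantin–Foias 1988, Ch. 1, (1.4): `H` = closure of `𝒱`), and vendors as the named fact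
`Torus.mem_energySpace_iff` its intrinsic description

  `v ∈ H ↔ (∀ θ ∈ C^∞(T^d), ∫ ⟪v, ∇θ⟫ = 0) ∧ ∫ v = 0`,

the periodic form of Constantin–Foias 1988, Prop. 1.8, (1.6) (`H = {u ∈ L² | div u = 0,
γ(u) = 0}` on a bounded Lipschitz domain; on `T^d` there is no boundary and the normal-trace
condition is replaced by the zero-mean condition `u₀ = 0` of Ch. 4, (4.33), where the periodic
`H` is *defined* as `{u ∈ L² | u₀ = 0, ⟨uₖ, k⟩ = 0}`).
`Literature.Analysis.FluidPDE.EnergySpaceTorus` restates the same fact under the inventory id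
**ns.S33** as `energySpace_characterisation` (definitionally equal,
`energySpace_characterisation_iff`). This file **proves** both:
`Torus.mem_energySpace_iff_holds` and `energySpace_characterisation_holds`.

It also assembles, under the same inventory id, the discharge
`stokesOperator_isSelfAdjoint_isPositive_holds` of the ns.S33 fact
`stokesOperator_isSelfAdjoint_isPositive` (`A = A† ≥ 0` for the Stokes operator on `T^d`;
Constantin–Foias 1988, Ch. 4, Prop. 4.2 and Thm. 4.3; Temam 1977, Ch. I §2.6) from the three
discharges `Torus.isSelfAdjoint_stokesOperatorH_holds` (`StokesTorusSelfAdjointProofs`),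
`Torus.isPositive_stokesOperatorH_holds` and `Torus.isPositive_stokesOperator_holds`
(`StokesTorusPositivityProofs`) of the corresponding `StokesTorus` facts, of which it is by
definition the conjunction (see the last section).

## Proof

* `H ⊆ {div v = 0 weakly, ∫ v = 0}`: the generators `𝒱` are weakly divergence free
  (integration by parts against `∇θ`) and mean zero, and both conditions are closed linear
  conditions in `L²`; this inclusion is already proved in the tree
  (`Torus.isWeaklyDivFree_of_mem_energySpace`, `Torus.integral_eq_zero_of_mem_energySpace` of
  `Literature.Analysis.FluidPDE.StatisticalSolutionEnergyEq`; Robinson–Rodrigo–Sadowski 2016,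
  Lemma 2.3).
* `{div v = 0 weakly, ∫ v = 0} ⊆ H`: let `P` be the orthogonal projection of `L²(T^d; ℝ^d)`
  onto the closed subspace `H` (`Torus.lerayProjector d`). On the Fourier side
  `(P v)^(k) = lerayCoeff k (v̂(k))` (`Torus.mFourierCoeff_lerayProjector_holds`, proved in
  `LerayProjectorTorusProofs`; Constantin–Foias 1988, (4.38)–(4.40)). If `∫ v = 0` then
  `v̂(0) = 0 = (P v)^(0)`, and if `v` is weakly divergence free then `k · v̂(k) = 0`
  (`Torus.IsWeaklyDivFree.sum_mul_mFourierCoeff_eq_zero`), so the multiplier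
  `c ↦ c − ((k·c)/|k|²) k` fixes `v̂(k)` for `k ≠ 0` (`Torus.leraySym_of_transversal`).
  Hence `P v` and `v` have the same Fourier coefficients, so `P v = v` by Parseval
  (`Torus.enorm_sq_coe_eq_tsum` applied to `v − P v`), i.e. `v ∈ range P = H`.

No new definitions and no new named facts; net effect: the facts `Torus.mem_energySpace_iff`
and `energySpace_characterisation` are discharged.

## Remark on the vendored locator

The docstring of `energySpace_characterisation` cites "Constantin–Foias 1988, Ch. 4,
Prop. 4.3". In the printed text the item numbered 4.3 is *Theorem* 4.3 (self-adjointness of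
the Stokes operator, bounded domain); the printed loci of the statement are Ch. 1, (1.4) and
Prop. 1.8 (1.6) (bounded domain) and Ch. 4, (4.33) (periodic case, where it is the definition of
`H`). The statement itself is the faithful periodic form and is proved here as vendored.

## References

* P. Constantin, C. Foias, *Navier–Stokes Equations*, Univ. Chicago Press (1988), Ch. 1,
  (1.4), Prop. 1.8 (1.6); Ch. 4, (4.33), (4.38)–(4.40). [ConstantinFoias1988]
* J. C. Robinson, J. L. Rodrigo, W. Sadowski, *The Three-Dimensional Navier–Stokes Equations:
  Classical Theory*, CUP (2016), §2.1: Def. 2.1, Lemma 2.3, Thm. 2.6, Def. 2.8 (pp. 42–45).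
  [RobinsonRodrigoSadowskiCUP2016]
* R. Temam, *Navier–Stokes Equations. Theory and Numerical Analysis*, North-Holland (1977),
  Ch. I, Thm. 1.4 and Rem. 1.6.
-/

noncomputable section

open MeasureTheory Filter UnitAddTorus
open scoped InnerProductSpace RealInnerProductSpace ENNReal

namespace Literature.Analysis.FluidPDE

namespace Torus

variable {d : Type*} [Fintype d]

/-- **Fourier uniqueness for `L²` classes of real vector fields on `T^d`**: two classes
`v, w ∈ L²(T^d; ℝ^d)` whose (complexified) Fourier coefficients agree are equal — Parseval
(`Torus.enorm_sq_coe_eq_tsum`) applied to `v - w`, all of whose coefficients vanish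
(`Torus.mFourierCoeff_complexify_coe_sub`) (Grafakos 2014, Prop. 3.2.7 (3); Constantin–Foias
1988, Ch. 4, (4.30)–(4.32)). [folklore] -/
theorem eq_of_forall_mFourierCoeff_complexify_coe_eq
    {v w : Lp (EuclideanSpace ℝ d) 2 (volume : Measure (UnitAddTorus d))}
    (h : ∀ k, mFourierCoeff (FunctionSpaces.EuclideanSpace.complexify ∘
        (v : UnitAddTorus d → EuclideanSpace ℝ d)) k =
      mFourierCoeff (FunctionSpaces.EuclideanSpace.complexify ∘
        (w : UnitAddTorus d → EuclideanSpace ℝ d)) k) :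
    v = w := by
  have h0 : ∀ k, mFourierCoeff (FunctionSpaces.EuclideanSpace.complexify ∘
      ((v - w : Lp (EuclideanSpace ℝ d) 2 (volume : Measure (UnitAddTorus d))) :
        UnitAddTorus d → EuclideanSpace ℝ d)) k = 0 :=
    fun k => by rw [mFourierCoeff_complexify_coe_sub, h k, sub_self]
  have hpar : ‖v - w‖ₑ ^ 2 = 0 := by
    rw [enorm_sq_coe_eq_tsum (v - w), ENNReal.tsum_eq_zero]
    intro k
    rw [h0 k, enorm_zero, zero_pow two_ne_zero]
  rwa [pow_eq_zero_iff two_ne_zero, enorm_eq_zero, sub_eq_zero] at hpar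

/-- The zero Fourier mode of a mean-zero real vector field vanishes:
`𝓕(complexify ∘ f)(0) = complexify (∫ f) = 0` (Constantin–Foias 1988, Ch. 4, (4.32) with
`k = 0`: `u₀` is the mean). [folklore] -/
private theorem mFourierCoeff_complexify_zero_of_hasZeroMean
    {f : UnitAddTorus d → EuclideanSpace ℝ d} (hf0 : FunctionSpaces.Torus.HasZeroMean f) :
    mFourierCoeff (FunctionSpaces.EuclideanSpace.complexify ∘ f) 0 = 0 := by
  have h0 : ∫ x, f x = 0 := hf0
  rw [FunctionSpaces.Torus.mFourierCoeff_eq_integral_volume]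
  simp only [neg_zero, mFourier_zero, ContinuousMap.one_apply, one_smul, Function.comp_apply]
  rw [FunctionSpaces.EuclideanSpace.complexify.integral_comp_comm f, h0, map_zero]

variable [DecidableEq d]

/-- **The hard inclusion `{div v = 0 weakly, ∫ v = 0} ⊆ H`** on `T^d`: a weakly
divergence-free, mean-zero `L²` vector field lies in the energy space `H = Torus.energySpace d`
(the `L²` closure of the span of the smooth solenoidal mean-zero fields). Proof: the orthogonal
projection `P v` onto `H` has the Fourier coefficients `lerayCoeff k (v̂(k))`
(`Torus.mFourierCoeff_lerayProjector_apply`; Constantin–Foias 1988, (4.38)–(4.40)), which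
coincide with `v̂(k)` because `v̂(0) = 0` (zero mean) and `k · v̂(k) = 0`
(`Torus.IsWeaklyDivFree.sum_mul_mFourierCoeff_eq_zero`, `Torus.leraySym_of_transversal`);
hence `P v = v` (`eq_of_forall_mFourierCoeff_complexify_coe_eq`) and `v ∈ H`
(Constantin–Foias 1988, Ch. 4, (4.33); Robinson–Rodrigo–Sadowski 2016, Def. 2.1 / Thm. 2.6).
[cite: ConstantinFoias1988, Ch. 4 (4.33), (4.38)–(4.40)] -/
theorem mem_energySpace_of_isWeaklyDivFree_of_hasZeroMean
    {v : Lp (EuclideanSpace ℝ d) 2 (volume : Measure (UnitAddTorus d))}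
    (hdiv : FunctionSpaces.Torus.IsWeaklyDivFree (v : UnitAddTorus d → EuclideanSpace ℝ d))
    (hmean : FunctionSpaces.Torus.HasZeroMean (v : UnitAddTorus d → EuclideanSpace ℝ d)) :
    v ∈ FunctionSpaces.Torus.energySpace d := by
  have hP : lerayProjector d v = v := by
    refine eq_of_forall_mFourierCoeff_complexify_coe_eq fun k => ?_
    rw [mFourierCoeff_lerayProjector_apply]
    by_cases hk : k = 0
    · subst hk
      rw [lerayCoeff_zero, mFourierCoeff_complexify_zero_of_hasZeroMean hmean]
    · rw [lerayCoeff_of_ne_zero hk]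
      exact leraySym_of_transversal (hdiv.sum_mul_mFourierCoeff_eq_zero (Lp.memLp v) k)
  rw [← hP]
  exact lerayProjector_apply_mem v

end Torus

end Literature.Analysis.FluidPDE

namespace Literature.Analysis.FunctionSpaces.Torus

variable {d : Type*} [Fintype d] [DecidableEq d]

/-- **Discharge of the named fact `Torus.mem_energySpace_iff`** (intrinsic description of the
energy space on the torus): for `v ∈ L²(T^d; ℝ^d)`,
`v ∈ H ↔ (∀ θ smooth, ∫ ⟪v, ∇θ⟫ = 0) ∧ ∫ v = 0` — the periodic form of Constantin–Foias
1988, Prop. 1.8 (1.6) (`H = {u ∈ L² | div u = 0, γ(u) = 0}`, with `H` the `L²` closure of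
`𝒱`, (1.4)), the normal trace being replaced on `T^d` by the zero-mean condition `u₀ = 0` of
Ch. 4, (4.33). The easy inclusion is `FluidPDE.Torus.isWeaklyDivFree_of_mem_energySpace` /
`FluidPDE.Torus.integral_eq_zero_of_mem_energySpace` (Robinson–Rodrigo–Sadowski 2016,
Lemma 2.3), the hard one `FluidPDE.Torus.mem_energySpace_of_isWeaklyDivFree_of_hasZeroMean`
(via the Leray projector, Constantin–Foias 1988, (4.38)–(4.40)).
[cite: ConstantinFoias1988, Ch. 1 Prop. 1.8 (1.6); Ch. 4 (4.33)] -/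
theorem mem_energySpace_iff_holds : mem_energySpace_iff (d := d) := fun _ =>
  ⟨fun hv => ⟨FluidPDE.Torus.isWeaklyDivFree_of_mem_energySpace hv,
      FluidPDE.Torus.integral_eq_zero_of_mem_energySpace hv⟩,
    fun h => FluidPDE.Torus.mem_energySpace_of_isWeaklyDivFree_of_hasZeroMean h.1 h.2⟩

end Literature.Analysis.FunctionSpaces.Torus

namespace Literature.Analysis.FluidPDE

variable {d : Type*} [Fintype d] [DecidableEq d]

/-- **ns.S33, discharged** (energy space on the torus; Constantin–Foias 1988, Ch. 1 (1.4) &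
Prop. 1.8 (1.6), Ch. 4 (4.33); Temam 1977, Ch. I Thm. 1.4 / Rem. 1.6, periodic case):
`H = Torus.energySpace d` is exactly the space of weakly divergence-free, mean-zero `L²` vector
fields on `T^d`. `energySpace_characterisation` is definitionally the prelude fact
`Torus.mem_energySpace_iff` (`energySpace_characterisation_iff`), discharged above as
`Torus.mem_energySpace_iff_holds`. (The vendored locator "Ch. 4, Prop. 4.3" is not the printed
numbering — the printed 4.3 is Theorem 4.3, self-adjointness of the Stokes operator; see the
module docstring.) [cite: ConstantinFoias1988, Ch. 1 Prop. 1.8 (1.6); Ch. 4 (4.33)] -/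
theorem energySpace_characterisation_holds : energySpace_characterisation (d := d) :=
  FunctionSpaces.Torus.mem_energySpace_iff_holds

end Literature.Analysis.FluidPDE

/-! ## ns.S33: the Stokes operator is self-adjoint and positive (assembly) -/

namespace Literature.Analysis.FluidPDE

variable {d : Type*} [Fintype d] [DecidableEq d]

/-- **ns.S33, discharged** (the Stokes operator `A = -P Δ = -Δ` on `T^d` is self-adjoint and
positive; Constantin–Foias 1988, Ch. 4, Prop. 4.2 with (4.4) and Thm. 4.3, in the space-periodic
setting (4.33)–(4.37) where `(A u)_k = 4π²|k|² u_k`; Foias–Manley–Rosa–Temam 2001, Ch. II §6,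
(6.16)–(6.18): "`A` is a positive self-adjoint operator"; Temam 1977, Ch. I §2.6):
`IsSelfAdjoint (Torus.stokesOperatorH d)`, `(Torus.stokesOperatorH d).IsPositive` and
`(Torus.stokesOperator d).IsPositive`. The fact is by definition the conjunction of the
`StokesTorus` facts `Torus.isSelfAdjoint_stokesOperatorH`, `Torus.isPositive_stokesOperatorH`,
`Torus.isPositive_stokesOperator`, discharged in `StokesTorusSelfAdjointProofs` /
`StokesTorusPositivityProofs` (Fourier-side proof: the graph relation reads
`ŵ(k) = 4π²|k|² v̂(k)`, Parseval gives symmetry and positivity, and `A† ≤ A` by testing the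
adjoint identity against the transversal real modes, whose span is dense in `H`).
[cite: Temam1977, Ch. I §2.6] [cite: ConstantinFoias1988, Ch. 4 Prop. 4.2, Thm. 4.3] -/
theorem stokesOperator_isSelfAdjoint_isPositive_holds :
    stokesOperator_isSelfAdjoint_isPositive (d := d) :=
  ⟨Torus.isSelfAdjoint_stokesOperatorH_holds, Torus.isPositive_stokesOperatorH_holds,
    Torus.isPositive_stokesOperator_holds⟩

end Literature.Analysis.FluidPDE
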